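import Summits.CriticalPhenomena.PercolationContinuityZ3.Theorems.Transplant.SkelNegBParamsFaceFloorsClrXA
import Summits.CriticalPhenomena.PercolationContinuityZ3.Theorems.Transplant.SkelNegBParamsBridgeFrameF
import HarnessLib

/-!
# N1 params, M3 group G-π (x-face) — **THE TWO REACH FLOORS OF AN x-FACE AT THE (ζ′) TUPLE**: the fields `hπ2X` (along x-run: origin + `(Nr+1)`
# sheared strides within the window radius `r`) and `hπ3X` (tangential y′-run: its origin `yT` + region `k`'s drift within `r`) of `Skelφ.FloorsX2`
# (SkelPhiFaceNumsXP2 :95–:100) at M3-FLOORS-SIGNATURE §1 (p1-g14, 2026-08-22; claim lane INBOX 07:57:35Z; conclusions = p3-g12's pinned `hπ2X_XA`/`hπ3X_XA`).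
THE ONE r-FLOOR: both fields are served from the single hypothesis **`hr : ∀ X : ℕ, X + 1 ≤ NegB.exA … → X ≤ r`** (BTB2: `r := Prm.Lp (SUA ex mx …) q` with
`KS.ex_le_Lp_UA` after `exA ≤ exAF c = ex`, slot-ledger ζ′ v2), i.e. every reach is shown `+ 1 ≤ exA`: the landing origin is within the face frames' budget
`|yL|₁ ≤ YbF` (hypothesis `hyl`, = the G-O origin inside core 1, cf. `core1LoF_l1`), the along run adds `(NrX+1)·U ≤ 600·Kq·U`, the cross shift `≤ 11·n_L + 1`,
and region `k ≤ N3X ≤ 200·Kq + 9` of the tangential run at most `1000·Kq·(11·n_L + ℓ_L) + 12` (the arithmetic of RootCrossYA's `hπ3_RA`), against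
`exA ≥ (Yb + 11055·n_L + 1000·ℓ_L + 20) + Kq·(Yb + 1000·U + 11055·n_L + 1000·ℓ_L + 20)`; `YbF ≤ 28·n_L + 2·ℓ_L + 22` needs `16·S_F ≤ M_L` (hypothesis `hSF`,
hp-8's `hSF16`) and `RA′ ≤ n_L` (`hnA`).
builds on p205010 (kernel theorem, internal audit signed; external expert review pending) — nothing in this file uses p205010; NOTHING is claimed about the node
`SamePDropOfSkeletonNeg₁` (OPEN); integer arithmetic only.
Lane `prim-bschramm-*`, seat `prim-bschramm-p1` (gen 14); helper file (`--supports stmt-CriticalPhenomena-4575 --as helper`); slot-ledger ζ′ v1/v2 (ex-monotone).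
* `clr_kterm_le` (region `k`'s drift, pure), `clr_crossOffX_l1` (the tangential origin's size), `clr_YbF_le`, `clr_floorπ_exA` (the budget `+ 1 ≤ exA`),
  **`hπ2X_XA`**, **`hπ3X_XA`**.
[cite: KozmaNitzan2024, §4 Lemma 12 (pp. 23–25)] [cite: MartineauTassion2017, §4.3 Lemma 4.2]
-/

noncomputable section

open scoped Classical

namespace Summit.CriticalPhenomena.PercolationContinuityZ3.Theorems.Transplant

namespace PlanarSkeletonNeg

namespace NegB

open Literature.Probability.Percolation Literature.Probability.LatticeModels SimpleGraph
open Literature.Probability.Percolation.KozmaNitzan.Cells (oth sgOf sgOf_sign)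
open SkelConc (Consts)
open Skelφ (shearUnit shearUnit_pos crossOffX yPrmW)
open Skelφ.StepI (DataN)
open TwoAxis.Para (modulus)
open Neg

namespace KS

/-! ## §1 Generic arithmetic (chain-free) -/

section Arith

/-- **Region `k`'s drift term of `hπ3X`, pure**: for `0 ≤ K ≤ B`, `|v| ≤ n`, `|h| ≤ 10n`, `U ≤ 11n`, `U·|sLo| ≤ nℓ` (`sLo ≥ 0`):
`|K·v| + (U·|K·sLo| + |h|·|K·v| + U)/n ≤ B·n + B·ℓ + 10·B·n + 11`. [folklore] -/
theorem clr_kterm_le {n : ℕ} (hn : 1 ≤ n) {h v U sLo K B ℓ : ℤ} (hv : |v| ≤ n) (hh : |h| ≤ 10 * (n : ℤ)) (hU : U ≤ 11 * (n : ℤ))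
    (hs0 : 0 ≤ sLo) (hs : U * sLo ≤ (n : ℤ) * ℓ) (hℓ : (0 : ℤ) ≤ ℓ) (hK0 : 0 ≤ K) (hKB : K ≤ B) :
    |K * v| + (U * |K * sLo| + |h| * |K * v| + U) / (n : ℤ) ≤ B * n + B * ℓ + 10 * B * n + 11 := by
  have hn0 : (0 : ℤ) < n := by exact_mod_cast hn
  have hB0 : 0 ≤ B := hK0.trans hKB
  have a1 : |K * v| ≤ B * (n : ℤ) := by rw [abs_mul, abs_of_nonneg hK0]; exact mul_le_mul hKB hv (abs_nonneg _) hB0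
  have a2 : U * |K * sLo| ≤ B * ((n : ℤ) * ℓ) := by
    rw [abs_of_nonneg (mul_nonneg hK0 hs0)]
    have e : U * (K * sLo) = K * (U * sLo) := by ring
    rw [e]
    have h1 : K * (U * sLo) ≤ K * ((n : ℤ) * ℓ) := mul_le_mul_of_nonneg_left hs hK0
    have hnl : (0 : ℤ) ≤ (n : ℤ) * ℓ := by positivity
    have h2 : K * ((n : ℤ) * ℓ) ≤ B * ((n : ℤ) * ℓ) := mul_le_mul_of_nonneg_right hKB hnl
    linarith
  have a3 : |h| * |K * v| ≤ 10 * (n : ℤ) * (B * (n : ℤ)) := mul_le_mul hh a1 (abs_nonneg _) (by positivity)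
  set Nn := U * |K * sLo| + |h| * |K * v| + U with hNn
  have hNn1 : Nn ≤ (n : ℤ) * (B * ℓ + 10 * B * n + 11) := by
    have e1 : (n : ℤ) * (B * ℓ + 10 * B * n + 11) = B * ((n : ℤ) * ℓ) + 10 * (n : ℤ) * (B * (n : ℤ)) + 11 * (n : ℤ) := by ring
    rw [e1]; linarith
  have hdiv : Nn / (n : ℤ) ≤ B * ℓ + 10 * B * n + 11 := by
    have := Int.ediv_le_ediv hn0 hNn1
    rwa [Int.mul_ediv_cancel_left _ hn0.ne'] at this
  linarith

end Arith

/-! ## §2 Sizes at the (ζ′) tuple -/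

section Sizes

variable (κ : Consts) {V : Type} [DecidableEq V] [Countable V] {G : SimpleGraph V} [G.LocallyFinite] (Φ : PlanarSkeletonNeg G) (t : V)
  (p : unitInterval) (D : DataN V) (c mk g f : ℕ)

/-- **The tangential origin's size**: `|yT 0| + |yT 1| ≤ |yL 0| + |yL 1| + (Nr+1)·U + 11·n_L + 1` for `yT = yL + crossOffX n_L h_L v_L σ σT Nr`
(`σ, σT = ±1`, `|v_L| ≤ n_L`, `|h_L| ≤ 10·n_L`). [folklore] -/
theorem clr_crossOffX_l1 (hN : EqNumL κ Φ t p D g f) (hκ : (hL κ Φ t p D g f).natAbs ≤ 10 * nL κ Φ t p D g f) (yL : Site 2)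
    {σ σT : ℤ} (hσ : σ = 1 ∨ σ = -1) (hσT : σT = 1 ∨ σT = -1) (Nr : ℕ) :
    ((yL + crossOffX (nL κ Φ t p D g f) (hL κ Φ t p D g f) (vL κ Φ t p D g f) σ σT Nr) 0).natAbs +
        ((yL + crossOffX (nL κ Φ t p D g f) (hL κ Φ t p D g f) (vL κ Φ t p D g f) σ σT Nr) 1).natAbs ≤
      (yL 0).natAbs + (yL 1).natAbs + (Nr + 1) * shearUnit (nL κ Φ t p D g f) (hL κ Φ t p D g f) + 11 * nL κ Φ t p D g f + 1 := by
  obtain ⟨hn1, -⟩ := one_le_of_eqNumL κ Φ t p D g f hN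
  have hn0 : (0 : ℤ) < (nL κ Φ t p D g f : ℤ) := by exact_mod_cast hn1
  have hv := abs_le.1 hN.v_le
  have hκ' : |hL κ Φ t p D g f| ≤ 10 * (nL κ Φ t p D g f : ℤ) := by rw [← Int.natCast_natAbs]; exact_mod_cast hκ
  have hh := abs_le.1 hκ'
  have hUe : (shearUnit (nL κ Φ t p D g f) (hL κ Φ t p D g f) : ℤ) = (nL κ Φ t p D g f : ℤ) + |hL κ Φ t p D g f| := by
    unfold Skelφ.shearUnit; push_cast [Int.natCast_natAbs]; rfl
  have hσabs : |σ| = 1 := by rcases hσ with h | h <;> simp [h]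
  have hσTabs : |σT| = 1 := by rcases hσT with h | h <;> simp [h]
  -- the cross shift's transverse rounding `⌊σT h v / n⌋ ∈ [−|h| − 1, |h|]`
  obtain ⟨f1, f2⟩ := RootArith.floor_sandwich (x := σT * hL κ Φ t p D g f * vL κ Φ t p D g f) hn0
  have hxv : |σT * hL κ Φ t p D g f * vL κ Φ t p D g f| ≤ |hL κ Φ t p D g f| * (nL κ Φ t p D g f : ℤ) := by
    rw [abs_mul, abs_mul, hσTabs, one_mul]; exact mul_le_mul_of_nonneg_left hN.v_le (abs_nonneg _)
  obtain ⟨x1, x2⟩ := abs_le.1 hxv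
  set q := σT * hL κ Φ t p D g f * vL κ Φ t p D g f / (nL κ Φ t p D g f : ℤ) with hq
  have hq1 : q ≤ |hL κ Φ t p D g f| := by
    by_contra hc; push Not at hc
    have : (nL κ Φ t p D g f : ℤ) * (|hL κ Φ t p D g f| + 1) ≤ (nL κ Φ t p D g f : ℤ) * q := mul_le_mul_of_nonneg_left (by linarith) hn0.le
    nlinarith
  have hq2 : -(|hL κ Φ t p D g f| + 1) ≤ q := by
    by_contra hc; push Not at hc
    have : (nL κ Φ t p D g f : ℤ) * q ≤ (nL κ Φ t p D g f : ℤ) * (-(|hL κ Φ t p D g f| + 1) - 1) := mul_le_mul_of_nonneg_left (by linarith) hn0.le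
    nlinarith
  have hk0 : (0 : ℤ) ≤ (Nr : ℤ) + 1 := by positivity
  have e0 : (yL + crossOffX (nL κ Φ t p D g f) (hL κ Φ t p D g f) (vL κ Φ t p D g f) σ σT Nr) 0 =
      yL 0 + (σ * (((Nr : ℤ) + 1) * (nL κ Φ t p D g f : ℤ)) + σT * vL κ Φ t p D g f) := by
    simp only [Pi.add_apply, Skelφ.crossOffX, Skelφ.pt_zero]
  have e1 : (yL + crossOffX (nL κ Φ t p D g f) (hL κ Φ t p D g f) (vL κ Φ t p D g f) σ σT Nr) 1 =
      yL 1 + (σ * (((Nr : ℤ) + 1) * hL κ Φ t p D g f) + q) := by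
    simp only [Pi.add_apply, Skelφ.crossOffX, Skelφ.pt_one, hq]
  have b0 : |σ * (((Nr : ℤ) + 1) * (nL κ Φ t p D g f : ℤ)) + σT * vL κ Φ t p D g f| ≤ ((Nr : ℤ) + 1) * (nL κ Φ t p D g f : ℤ) + nL κ Φ t p D g f := by
    calc |σ * (((Nr : ℤ) + 1) * (nL κ Φ t p D g f : ℤ)) + σT * vL κ Φ t p D g f|
        ≤ |σ * (((Nr : ℤ) + 1) * (nL κ Φ t p D g f : ℤ))| + |σT * vL κ Φ t p D g f| := abs_add_le _ _
      _ ≤ ((Nr : ℤ) + 1) * (nL κ Φ t p D g f : ℤ) + nL κ Φ t p D g f := by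
          have p1 : |σ * (((Nr : ℤ) + 1) * (nL κ Φ t p D g f : ℤ))| = ((Nr : ℤ) + 1) * (nL κ Φ t p D g f : ℤ) := by
            rw [abs_mul, hσabs, one_mul, abs_of_nonneg (by positivity)]
          have p2 : |σT * vL κ Φ t p D g f| ≤ (nL κ Φ t p D g f : ℤ) := by rw [abs_mul, hσTabs, one_mul]; exact hN.v_le
          linarith
  have b1 : |σ * (((Nr : ℤ) + 1) * hL κ Φ t p D g f) + q| ≤ ((Nr : ℤ) + 1) * |hL κ Φ t p D g f| + (10 * (nL κ Φ t p D g f : ℤ) + 1) := by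
    calc |σ * (((Nr : ℤ) + 1) * hL κ Φ t p D g f) + q| ≤ |σ * (((Nr : ℤ) + 1) * hL κ Φ t p D g f)| + |q| := abs_add_le _ _
      _ ≤ ((Nr : ℤ) + 1) * |hL κ Φ t p D g f| + (10 * (nL κ Φ t p D g f : ℤ) + 1) := by
          have p1 : |σ * (((Nr : ℤ) + 1) * hL κ Φ t p D g f)| = ((Nr : ℤ) + 1) * |hL κ Φ t p D g f| := by
            rw [abs_mul, hσabs, one_mul, abs_mul, abs_of_nonneg hk0]
          have p2 : |q| ≤ 10 * (nL κ Φ t p D g f : ℤ) + 1 := abs_le.2 ⟨by linarith, by linarith⟩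
          linarith
  have key : (((yL + crossOffX (nL κ Φ t p D g f) (hL κ Φ t p D g f) (vL κ Φ t p D g f) σ σT Nr) 0).natAbs : ℤ) +
      (((yL + crossOffX (nL κ Φ t p D g f) (hL κ Φ t p D g f) (vL κ Φ t p D g f) σ σT Nr) 1).natAbs : ℤ) ≤
      ((yL 0).natAbs : ℤ) + ((yL 1).natAbs : ℤ) + ((Nr : ℤ) + 1) * (shearUnit (nL κ Φ t p D g f) (hL κ Φ t p D g f) : ℤ) + 11 * (nL κ Φ t p D g f : ℤ) + 1 := by
    simp only [Int.natCast_natAbs]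
    rw [e0, e1, hUe]
    have t0 := abs_add_le (yL 0) (σ * (((Nr : ℤ) + 1) * (nL κ Φ t p D g f : ℤ)) + σT * vL κ Φ t p D g f)
    have t1 := abs_add_le (yL 1) (σ * (((Nr : ℤ) + 1) * hL κ Φ t p D g f) + q)
    nlinarith [abs_nonneg (hL κ Φ t p D g f)]
  exact_mod_cast key

/-- **The face frames' budget is small**: `YbF ≤ 28·n_L + 2·ℓ_L + 22` under `16·S_F ≤ M_L` (`M_L < n_L`), `RA′ ≤ n_L`, `|h_L| ≤ 10·n_L`. [folklore] -/
theorem clr_YbF_le (hκ : (hL κ Φ t p D g f).natAbs ≤ 10 * nL κ Φ t p D g f) (hSF : 16 * SF κ Φ t p D c mk ≤ ML κ Φ t p D g)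
    (hnA : 2000 * Neg.Kq κ * (RA' κ Φ t p D mk + 2) ≤ nL κ Φ t p D g f) :
    YbF κ Φ t p D c mk g f ≤ 28 * nL κ Φ t p D g f + 2 * ℓL κ Φ t p D g f + 22 := by
  have h1 := (ML_lt_nL κ Φ t p D g f).1
  have h2 : RA' κ Φ t p D mk ≤ nL κ Φ t p D g f := by
    have : RA' κ Φ t p D mk ≤ 2000 * Neg.Kq κ * (RA' κ Φ t p D mk + 2) := by have := Neg.one_le_Kq κ; nlinarith
    omega
  unfold YbF; omega

/-- **THE G-π BUDGET**: `YbF + 600·Kq·U + 11·n_L + 1 + (1000·Kq·n_L + 1000·Kq·ℓ_L + 10000·Kq·n_L + 12) + 1 ≤ exA`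
(`exA ≥ (Yb + 11055 n_L + 1000 ℓ_L + 20) + Kq·(Yb + 1000 U + 11055 n_L + 1000 ℓ_L + 20)`). [folklore] -/
theorem clr_floorπ_exA (hκ : (hL κ Φ t p D g f).natAbs ≤ 10 * nL κ Φ t p D g f) (hSF : 16 * SF κ Φ t p D c mk ≤ ML κ Φ t p D g)
    (hnA : 2000 * Neg.Kq κ * (RA' κ Φ t p D mk + 2) ≤ nL κ Φ t p D g f) :
    YbF κ Φ t p D c mk g f + 600 * Neg.Kq κ * shearUnit (nL κ Φ t p D g f) (hL κ Φ t p D g f) + 11 * nL κ Φ t p D g f + 1 +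
        (1000 * Neg.Kq κ * nL κ Φ t p D g f + 1000 * Neg.Kq κ * ℓL κ Φ t p D g f + 10000 * Neg.Kq κ * nL κ Φ t p D g f + 12) + 1 ≤
      exA κ Φ t p D g f := by
  have hY := clr_YbF_le κ Φ t p D c mk g f hκ hSF hnA
  have hq := Neg.one_le_Kq κ
  have hex := (exR_le_exR2 κ Φ t p D g f).2
  have e : exA κ Φ t p D g f = exR2 κ Φ t p D g f +
      Neg.Kq κ * (Yb κ Φ t p D g f + 1000 * shearUnit (nL κ Φ t p D g f) (hL κ Φ t p D g f) + 11055 * nL κ Φ t p D g f + 1000 * ℓL κ Φ t p D g f + 20) +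
      exCA κ Φ t p D g f := rfl
  have hn : 11 * nL κ Φ t p D g f ≤ 11 * (Neg.Kq κ * nL κ Φ t p D g f) := Nat.mul_le_mul_left _ (Nat.le_mul_of_pos_left _ hq)
  rw [e, Nat.mul_add, Nat.mul_add, Nat.mul_add, Nat.mul_add]
  have e2 : Neg.Kq κ * (1000 * shearUnit (nL κ Φ t p D g f) (hL κ Φ t p D g f)) = 1000 * (Neg.Kq κ * shearUnit (nL κ Φ t p D g f) (hL κ Φ t p D g f)) := by ring
  have e3 : Neg.Kq κ * (11055 * nL κ Φ t p D g f) = 11055 * (Neg.Kq κ * nL κ Φ t p D g f) := by ring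
  have e4 : Neg.Kq κ * (1000 * ℓL κ Φ t p D g f) = 1000 * (Neg.Kq κ * ℓL κ Φ t p D g f) := by ring
  have e5 : 1000 * Neg.Kq κ * nL κ Φ t p D g f = 1000 * (Neg.Kq κ * nL κ Φ t p D g f) := by ring
  have e6 : 10000 * Neg.Kq κ * nL κ Φ t p D g f = 10000 * (Neg.Kq κ * nL κ Φ t p D g f) := by ring
  have e7 : 600 * Neg.Kq κ * shearUnit (nL κ Φ t p D g f) (hL κ Φ t p D g f) = 600 * (Neg.Kq κ * shearUnit (nL κ Φ t p D g f) (hL κ Φ t p D g f)) := by ring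
  have e8 : 1000 * Neg.Kq κ * ℓL κ Φ t p D g f = 1000 * (Neg.Kq κ * ℓL κ Φ t p D g f) := by ring
  rw [e2, e3, e4, e5, e6, e7, e8]
  omega

end Sizes

/-! ## §3 The two G-π fields at the (ζ′) tuple -/

section Fields

variable (κ : Consts) {V : Type} [DecidableEq V] [Countable V] {G : SimpleGraph V} [G.LocallyFinite] (Φ : PlanarSkeletonNeg G) (t : V)
  (p : unitInterval) (D : DataN V) (c mk g f : ℕ)

/-- **M3 x-face field `hπ2X`** at the (ζ′) tuple (pinned conclusion; premise block trimmed; added served hyps `hSF`, `hyl`, `hr`): the along run's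
sheared prism lies within the window radius. [cite: KozmaNitzan2024, §4 Lemma 12 (pp. 23–25)] -/
theorem hπ2X_XA (hN : EqNumL κ Φ t p D g f) (hκ : (hL κ Φ t p D g f).natAbs ≤ 10 * nL κ Φ t p D g f)
    (hnA : 2000 * Neg.Kq κ * (RA' κ Φ t p D mk + 2) ≤ nL κ Φ t p D g f) (hSF : 16 * SF κ Φ t p D c mk ≤ ML κ Φ t p D g)
    (x : Site 2) (du : MDir) (hd : du.1 = 0) (j : ℕ) (hj : j < (fcellsA κ Φ t p D g f).K) (z : Site 2) {E : ℕ}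
    (hlev1 : (fcellsA κ Φ t p D g f).faceL 0 j - E ≤ (fcellsA κ Φ t p D g f).lev du x z) (hlev2 : (fcellsA κ Φ t p D g f).lev du x z ≤ (fcellsA κ Φ t p D g f).faceL 0 j + E)
    (hEu : (E : ℤ) ≤ u₀A κ Φ t p D g f)
    (yL : Site 2) (he0 : |FcA κ Φ t p D g f (yTX0 κ Φ t p D g f yL (σTX κ Φ t p D g f yL x z))| ≤ 6 * u₀A κ Φ t p D g f)
    (hyl : (yL 0).natAbs + (yL 1).natAbs ≤ YbF κ Φ t p D c mk g f) (r : ℕ) (hr : ∀ X : ℕ, X + 1 ≤ exA κ Φ t p D g f → X ≤ r) :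
    ((yL 0).natAbs + (yL 1).natAbs) + ((NrX κ Φ t p D g f yL (σTX κ Φ t p D g f yL x z) x du z) + 1) * shearUnit (nL κ Φ t p D g f) (prFA κ Φ t p D g f).h ≤ r := by
  have eh : (prFA κ Φ t p D g f).h = hL κ Φ t p D g f := rfl
  rw [eh]
  have hu : 1 ≤ u₀A κ Φ t p D g f := (units_eqA κ Φ t p D g f).2.2.2.2.2.2.1
  obtain ⟨-, hNr⟩ := NrX_range κ Φ t p D g f hN x du hd z hj hlev1 hlev2 yL (σTX κ Φ t p D g f yL x z) he0 (by linarith)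
  have hfl := clr_floorπ_exA κ Φ t p D c mk g f hκ hSF hnA
  refine hr _ (le_trans ?_ hfl)
  have h1 : (NrX κ Φ t p D g f yL (σTX κ Φ t p D g f yL x z) x du z + 1) * shearUnit (nL κ Φ t p D g f) (hL κ Φ t p D g f) ≤
      600 * Neg.Kq κ * shearUnit (nL κ Φ t p D g f) (hL κ Φ t p D g f) := Nat.mul_le_mul_right _ hNr
  omega

/-- **M3 x-face field `hπ3X`** at the (ζ′) tuple (pinned conclusion; premise block trimmed; added served hyps `hSF`, `hyl`, `hr`): the tangential
y′-run's origin plus every region's drift lies within the window radius. [cite: KozmaNitzan2024, §4 Lemma 12 (pp. 23–25)] -/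
theorem hπ3X_XA (hN : EqNumL κ Φ t p D g f) (hκ : (hL κ Φ t p D g f).natAbs ≤ 10 * nL κ Φ t p D g f)
    (hnA : 2000 * Neg.Kq κ * (RA' κ Φ t p D mk + 2) ≤ nL κ Φ t p D g f) (hℓA : 22000 * Neg.Kq κ * (RA' κ Φ t p D mk + 2) ≤ ℓL κ Φ t p D g f)
    (hSF : 16 * SF κ Φ t p D c mk ≤ ML κ Φ t p D g)
    (x : Site 2) (du : MDir) (hd : du.1 = 0) (j : ℕ) (hj : j < (fcellsA κ Φ t p D g f).K) (z : Site 2) {E : ℕ} {kE : ℤ}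
    (hlev1 : (fcellsA κ Φ t p D g f).faceL 0 j - E ≤ (fcellsA κ Φ t p D g f).lev du x z) (hlev2 : (fcellsA κ Φ t p D g f).lev du x z ≤ (fcellsA κ Φ t p D g f).faceL 0 j + E)
    (hz : |z 1 - (fcellsA κ Φ t p D g f).cen x 1| ≤ kE) (hEu : (E : ℤ) ≤ u₀A κ Φ t p D g f) (hkE : kE ≤ 5 * ((fcellsA κ Φ t p D g f).r 1 : ℤ))
    (yL : Site 2) (he0 : |FcA κ Φ t p D g f (yTX0 κ Φ t p D g f yL (σTX κ Φ t p D g f yL x z))| ≤ 6 * u₀A κ Φ t p D g f)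
    (he1 : |F1cA κ Φ t p D g f yL| ≤ 6 * u₁A κ Φ t p D g f)
    (hyl : (yL 0).natAbs + (yL 1).natAbs ≤ YbF κ Φ t p D c mk g f) (r : ℕ) (hr : ∀ X : ℕ, X + 1 ≤ exA κ Φ t p D g f → X ≤ r) :
    ∀ k ≤ (N3X κ Φ t p D g f yL x z), (((yL + crossOffX (nL κ Φ t p D g f) (prFA κ Φ t p D g f).h (prFA κ Φ t p D g f).vα (sgOf du) (σTX κ Φ t p D g f yL x z) (NrX κ Φ t p D g f yL (σTX κ Φ t p D g f yL x z) x du z)) 0).natAbs + ((yL + crossOffX (nL κ Φ t p D g f) (prFA κ Φ t p D g f).h (prFA κ Φ t p D g f).vα (sgOf du) (σTX κ Φ t p D g f yL x z) (NrX κ Φ t p D g f yL (σTX κ Φ t p D g f yL x z) x du z)) 1).natAbs) + (((((k + 1 : ℕ) : ℤ) * (prFA κ Φ t p D g f).vα).natAbs + (((shearUnit (nL κ Φ t p D g f) (prFA κ Φ t p D g f).h : ℤ) * |((k + 1 : ℕ) : ℤ) * (yPrmW (nL κ Φ t p D g f) (ℓL κ Φ t p D g f) (prFA κ Φ t p D g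 f).h (prFA κ Φ t p D g f).vα (RA' κ Φ t p D mk) (qB3XA κ Φ t p D g f (RA' κ Φ t p D mk)) (N3X κ Φ t p D g f yL x z)).sLo| + |(prFA κ Φ t p D g f).h| * |((k + 1 : ℕ) : ℤ) * (prFA κ Φ t p D g f).vα| + shearUnit (nL κ Φ t p D g f) (prFA κ Φ t p D g f).h) / (nL κ Φ t p D g f)).natAbs + 1)) ≤ r := by
  have eh : (prFA κ Φ t p D g f).h = hL κ Φ t p D g f := rfl
  have ev : (prFA κ Φ t p D g f).vα = vL κ Φ t p D g f := rfl
  simp only [eh, ev]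
  intro k hk
  obtain ⟨hn1, -⟩ := one_le_of_eqNumL κ Φ t p D g f hN
  have hn0 : (0 : ℤ) < (nL κ Φ t p D g f : ℤ) := by exact_mod_cast hn1
  have hu0 : 1 ≤ u₀A κ Φ t p D g f := (units_eqA κ Φ t p D g f).2.2.2.2.2.2.1
  have hu1 : 1 ≤ u₁A κ Φ t p D g f := (units_eqA κ Φ t p D g f).2.2.2.2.2.2.2
  have hσ : sgOf du = 1 ∨ sgOf du = -1 := sgOf_sign du
  have hσT := (N3X_spec κ Φ t p D g f yL x z).1
  have hU := shearUnit_pos hn1 (hL κ Φ t p D g f)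
  obtain ⟨-, hU2⟩ := clr_shearUnit_bounds κ Φ t p D g f hκ
  have hκ' : |hL κ Φ t p D g f| ≤ 10 * (nL κ Φ t p D g f : ℤ) := by rw [← Int.natCast_natAbs]; exact_mod_cast hκ
  have hq1 : 1 ≤ Neg.Kq κ := Neg.one_le_Kq κ
  have hℓ11 : (11 : ℤ) ≤ (ℓL κ Φ t p D g f : ℤ) := by
    have h2 : 1 * (0 + 2) ≤ Neg.Kq κ * (RA' κ Φ t p D mk + 2) := Nat.mul_le_mul hq1 (by omega)
    have : 11 ≤ ℓL κ Φ t p D g f := by nlinarith only [hℓA, h2]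
    exact_mod_cast this
  have hnℓ : (nL κ Φ t p D g f : ℤ) * 11 ≤ (nL κ Φ t p D g f : ℤ) * ℓL κ Φ t p D g f := mul_le_mul_of_nonneg_left hℓ11 hn0.le
  have sL' : (shearUnit (nL κ Φ t p D g f) (hL κ Φ t p D g f) : ℤ) * sLoY κ Φ t p D g f ≤
      (nL κ Φ t p D g f : ℤ) * ℓL κ Φ t p D g f - (shearUnit (nL κ Φ t p D g f) (hL κ Φ t p D g f) : ℤ) + 1 := by unfold sLoY; exact Int.mul_ediv_self_le hU.ne'
  have hs0 : 0 ≤ sLoY κ Φ t p D g f := by unfold sLoY; exact Int.ediv_nonneg (by linarith only [hU2, hnℓ]) hU.le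
  obtain ⟨-, hNr⟩ := NrX_range κ Φ t p D g f hN x du hd z hj hlev1 hlev2 yL (σTX κ Φ t p D g f yL x z) he0 (by linarith only [hEu, hu0])
  have hN3 := N3X_range κ Φ t p D g f yL x z hz hkE he1 (by linarith only [hu1])
  have hk1 : ((k + 1 : ℕ) : ℤ) ≤ 1000 * (Neg.Kq κ : ℤ) := by
    have h3 : k + 1 ≤ 1000 * Neg.Kq κ := by omega
    exact_mod_cast h3
  have hterm := clr_kterm_le hn1 hN.v_le hκ' hU2 hs0 (by linarith only [sL', hU]) (by positivity : (0 : ℤ) ≤ (ℓL κ Φ t p D g f : ℤ))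
    (Nat.cast_nonneg _ : (0 : ℤ) ≤ ((k + 1 : ℕ) : ℤ)) hk1
  have hNn0 : 0 ≤ (shearUnit (nL κ Φ t p D g f) (hL κ Φ t p D g f) : ℤ) * |((k + 1 : ℕ) : ℤ) * sLoY κ Φ t p D g f| +
      |hL κ Φ t p D g f| * |((k + 1 : ℕ) : ℤ) * vL κ Φ t p D g f| + (shearUnit (nL κ Φ t p D g f) (hL κ Φ t p D g f) : ℤ) := by
    have a1 := mul_nonneg hU.le (abs_nonneg (((k + 1 : ℕ) : ℤ) * sLoY κ Φ t p D g f))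
    have a2 := mul_nonneg (abs_nonneg (hL κ Φ t p D g f)) (abs_nonneg (((k + 1 : ℕ) : ℤ) * vL κ Φ t p D g f))
    linarith only [a1, a2, hU]
  have hdiv0 := Int.ediv_nonneg hNn0 hn0.le
  have hNr' : (((NrX κ Φ t p D g f yL (σTX κ Φ t p D g f yL x z) x du z) : ℤ) + 1) * (shearUnit (nL κ Φ t p D g f) (hL κ Φ t p D g f) : ℤ) ≤
      600 * (Neg.Kq κ : ℤ) * (shearUnit (nL κ Φ t p D g f) (hL κ Φ t p D g f) : ℤ) := by
    have : (((NrX κ Φ t p D g f yL (σTX κ Φ t p D g f yL x z) x du z) : ℤ) + 1) ≤ 600 * (Neg.Kq κ : ℤ) := by exact_mod_cast hNr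
    exact mul_le_mul_of_nonneg_right this hU.le
  -- the two large facts last
  have hfl := clr_floorπ_exA κ Φ t p D c mk g f hκ hSF hnA
  have hT := clr_crossOffX_l1 κ Φ t p D g f hN hκ yL hσ hσT (NrX κ Φ t p D g f yL (σTX κ Φ t p D g f yL x z) x du z)
  refine hr _ (le_trans ?_ hfl)
  have hsLo : (yPrmW (nL κ Φ t p D g f) (ℓL κ Φ t p D g f) (hL κ Φ t p D g f) (vL κ Φ t p D g f) (RA' κ Φ t p D mk)
      (qB3XA κ Φ t p D g f (RA' κ Φ t p D mk)) (N3X κ Φ t p D g f yL x z)).sLo = sLoY κ Φ t p D g f := rfl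
  rw [hsLo]
  rw [← Nat.cast_le (α := ℤ)] at hT hyl ⊢
  push_cast at hdiv0 hterm
  push_cast [Int.natCast_natAbs] at hT hyl ⊢
  rw [abs_of_nonneg hdiv0]
  linarith only [hT, hyl, hNr', hterm]

end Fields

end KS

end NegB

end PlanarSkeletonNeg

end Summit.CriticalPhenomena.PercolationContinuityZ3.Theorems.Transplant

end
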